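import Literature.Analysis.PDE.WeakHarnackLocal
import HarnessLib

/-!
# The absorption step (Gilbarg–Trudinger (9.55)–(9.56), normalized)

From the core estimate `(S/2)ⁿ ω ≤ K₁ ω + K₂ Sⁿ μ(Ω' ∩ B_α)` (`barrier_core_estimate`): if the set
where `u + N < 1` occupies a small fraction `θ₀` of `B₁` inside `B_α`, then `S ≤ C₁` and hence
`-log(u + N) ≤ C` on `B̄_ρ` (`ρ < 1`) — the normalized form of GT's (9.56)
"`|K⁺| ≤ θ|K| ⇒ sup_{K_{3r}} w ≤ C`", with explicit constants.

## References

* D. Gilbarg, N. S. Trudinger, *Elliptic Partial Differential Equations of Second Order* (2001),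
  proof of Theorem 9.22, (9.55)–(9.56). [GilbargTrudinger2001]
-/

noncomputable section

open Set InnerProductSpace RealInnerProductSpace Matrix Filter Metric MeasureTheory
open scoped Topology ENNReal

namespace Literature.Analysis.PDE.KrylovSafonov

open Literature.Analysis.PDE.ABP

variable {E : Type*} [NormedAddCommGroup E] [InnerProductSpace ℝ E] [FiniteDimensional ℝ E]
  [MeasurableSpace E] [BorelSpace E] {ι : Type*} [Fintype ι] [DecidableEq ι]

/-- The constant `K₁ = 2ⁿ((4β²Λ+1)/(nλ))ⁿ` of the core estimate. [cite: GilbargTrudinger2001, (9.54)] -/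
def coreK₁ (n : ℕ) (lam Λ : ℝ) (m : ℕ) : ℝ :=
  2 ^ n * ((4 * ((m + 2 : ℕ) : ℝ) ^ 2 * Λ + 1) / (n * lam)) ^ n

/-- The constant `K₂ = 2ⁿ(c/(nλ))ⁿ`, `c = 2βnΛ/(1-α²)`, of the core estimate.
[cite: GilbargTrudinger2001, (9.54)] -/
def coreK₂ (n : ℕ) (lam Λ : ℝ) (m : ℕ) (α : ℝ) : ℝ :=
  2 ^ n * ((2 * ((m + 2 : ℕ) : ℝ) * (n * Λ) / (1 - α ^ 2)) / (n * lam)) ^ n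

/-- **The smallness threshold** `θ₀ = 2^{-(n+1)}/(K₂ + 1)`. [cite: GilbargTrudinger2001, (9.55)] -/
def thetaZero (n : ℕ) (lam Λ : ℝ) (m : ℕ) (α : ℝ) : ℝ :=
  (2 ^ (n + 1))⁻¹ / (coreK₂ n lam Λ m α + 1)

/-- **The supremum bound** `C₁ = (2^{n+1} K₁)^{1/n}`. [cite: GilbargTrudinger2001, (9.56)] -/
def supBound (n : ℕ) (lam Λ : ℝ) (m : ℕ) : ℝ :=
  (2 ^ (n + 1) * coreK₁ n lam Λ m) ^ (n : ℝ)⁻¹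

omit [DecidableEq ι] [Fintype ι] in
/-- `K₁ ≥ 0`. [folklore] -/
theorem coreK₁_nonneg (n : ℕ) {lam Λ : ℝ} (hlam : 0 < lam) (hΛ : 0 ≤ Λ) (m : ℕ) :
    0 ≤ coreK₁ n lam Λ m := by
  unfold coreK₁; positivity

omit [DecidableEq ι] [Fintype ι] in
/-- `K₂ ≥ 0`. [folklore] -/
theorem coreK₂_nonneg (n : ℕ) {lam Λ : ℝ} (hlam : 0 < lam) (hΛ : 0 ≤ Λ) (m : ℕ) {α : ℝ}
    (hα1 : α ^ 2 < 1) : 0 ≤ coreK₂ n lam Λ m α := by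
  unfold coreK₂
  have : 0 ≤ 2 * ((m + 2 : ℕ) : ℝ) * (n * Λ) / (1 - α ^ 2) := div_nonneg (by positivity) (by linarith)
  positivity

omit [DecidableEq ι] [Fintype ι] in
/-- `θ₀ > 0`. [folklore] -/
theorem thetaZero_pos (n : ℕ) {lam Λ : ℝ} (hlam : 0 < lam) (hΛ : 0 ≤ Λ) (m : ℕ) {α : ℝ}
    (hα1 : α ^ 2 < 1) : 0 < thetaZero n lam Λ m α := by
  unfold thetaZero
  have := coreK₂_nonneg n hlam hΛ m hα1
  positivity

omit [DecidableEq ι] [Fintype ι] in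
/-- `C₁ ≥ 0`. [folklore] -/
theorem supBound_nonneg (n : ℕ) {lam Λ : ℝ} (hlam : 0 < lam) (hΛ : 0 ≤ Λ) (m : ℕ) :
    0 ≤ supBound n lam Λ m := by
  unfold supBound
  exact Real.rpow_nonneg (mul_nonneg (by positivity) (coreK₁_nonneg n hlam hΛ m)) _

omit [DecidableEq ι] [Fintype ι] in
/-- **The absorption arithmetic**: `(S/2)ⁿ ≤ K₁ + K₂ Sⁿ θ₀` with `θ₀ = 2^{-(n+1)}/(K₂+1)` forces
`S ≤ C₁ = (2^{n+1}K₁)^{1/n}`. [cite: GilbargTrudinger2001, (9.55)–(9.56)] -/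
theorem le_supBound_of_core {n : ℕ} (hn : n ≠ 0) {lam Λ : ℝ} (hlam : 0 < lam) (hΛ : 0 ≤ Λ) {m : ℕ}
    {α : ℝ} (hα1 : α ^ 2 < 1) {S : ℝ} (hS : 0 ≤ S)
    (h : (S / 2) ^ n ≤ coreK₁ n lam Λ m + coreK₂ n lam Λ m α * S ^ n * thetaZero n lam Λ m α) :
    S ≤ supBound n lam Λ m := by
  set K₁ := coreK₁ n lam Λ m
  set K₂ := coreK₂ n lam Λ m α
  have hK₁ : 0 ≤ K₁ := coreK₁_nonneg n hlam hΛ m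
  have hK₂ : 0 ≤ K₂ := coreK₂_nonneg n hlam hΛ m hα1
  have hθ : K₂ * thetaZero n lam Λ m α ≤ (2 ^ (n + 1))⁻¹ := by
    unfold thetaZero
    rw [mul_div_assoc', div_le_iff₀ (by positivity)]
    nlinarith [inv_nonneg.2 (by positivity : (0 : ℝ) ≤ 2 ^ (n + 1))]
  have hSn : 0 ≤ S ^ n := pow_nonneg hS n
  have h2 : (S / 2) ^ n = S ^ n / 2 ^ n := by rw [div_pow]
  have h3 : S ^ n / 2 ^ n ≤ K₁ + S ^ n * (2 ^ (n + 1))⁻¹ := by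
    rw [← h2]
    calc (S / 2) ^ n ≤ K₁ + K₂ * S ^ n * thetaZero n lam Λ m α := h
      _ = K₁ + S ^ n * (K₂ * thetaZero n lam Λ m α) := by ring
      _ ≤ K₁ + S ^ n * (2 ^ (n + 1))⁻¹ := by nlinarith [mul_le_mul_of_nonneg_left hθ hSn]
  have h4 : S ^ n ≤ 2 ^ (n + 1) * K₁ := by
    have h2n : (0 : ℝ) < 2 ^ n := by positivity
    have e1 : S ^ n / 2 ^ n = S ^ n * (2 * (2 ^ (n + 1))⁻¹) := by
      rw [pow_succ]; field_simp
    rw [e1] at h3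
    have : S ^ n * (2 ^ (n + 1))⁻¹ ≤ K₁ := by nlinarith
    calc S ^ n = (S ^ n * (2 ^ (n + 1))⁻¹) * 2 ^ (n + 1) := by field_simp
      _ ≤ K₁ * 2 ^ (n + 1) := mul_le_mul_of_nonneg_right this (by positivity)
      _ = 2 ^ (n + 1) * K₁ := mul_comm _ _
  have h5 : S ^ n ≤ supBound n lam Λ m ^ n := by
    unfold supBound
    rwa [Real.rpow_inv_natCast_pow (mul_nonneg (by positivity) hK₁) hn]
  exact (pow_le_pow_iff_left₀ hS (supBound_nonneg n hlam hΛ m) hn).1 h5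

/-- **Gilbarg–Trudinger (9.55)–(9.56), normalized.** On the unit ball, under the hypotheses of
`barrier_core_estimate`, if `μ({u + N < 1} ∩ B₁ ∩ B_α) ≤ θ₀ μ(B₁)` then
`-log(u(y) + N) ≤ C₁/(1-ρ²)^{m+2}` for `‖y‖ ≤ ρ < 1`.
[cite: GilbargTrudinger2001, proof of Thm 9.22, (9.55)–(9.56)] -/
theorem negLog_le_of_small_measure [Nonempty ι] (μ : Measure E) [μ.IsAddHaarMeasure]
    (b : OrthonormalBasis ι ℝ E) {U : Set E} (hU : IsOpen U) (hBU : closedBall (0 : E) 1 ⊆ U)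
    {u f : E → ℝ} {N : ℝ} (hu : ContDiffOn ℝ 2 u U) (hu0 : ∀ y ∈ closedBall (0 : E) 1, 0 ≤ u y)
    (hN : 0 < N) (hf : ∀ y ∈ ball (0 : E) 1, |f y| ≤ N)
    {a : E → Matrix ι ι ℝ} (ha : ∀ y ∈ ball (0 : E) 1, (a y).IsSymm) {lam Λ : ℝ} (hlam0 : 0 < lam)
    (hΛ0 : 0 ≤ Λ) (hlam : ∀ y ∈ ball (0 : E) 1, ∀ ξ : ι → ℝ, lam * (ξ ⬝ᵥ ξ) ≤ ξ ⬝ᵥ (a y *ᵥ ξ))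
    (hΛ : ∀ y ∈ ball (0 : E) 1, ∀ ξ : ι → ℝ, ξ ⬝ᵥ (a y *ᵥ ξ) ≤ Λ * (ξ ⬝ᵥ ξ))
    (hsuper : ∀ y ∈ ball (0 : E) 1, pair (a y) (hessianMatrix u b y) ≤ f y)
    {m : ℕ} {α : ℝ} (hα0 : 0 < α) (hα1 : α ^ 2 < 1)
    (hβl : Fintype.card ι * Λ ≤ 2 * (((m + 2 : ℕ) : ℝ) - 1) * lam * α ^ 2)
    (hθ : μ ({y | y ∈ ball (0 : E) 1 ∧ u y + N < 1} ∩ ball (0 : E) α) ≤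
      ENNReal.ofReal (thetaZero (Fintype.card ι) lam Λ m α) * μ (ball (0 : E) 1))
    {ρ : ℝ} (hρ0 : 0 ≤ ρ) (hρ1 : ρ < 1) {y : E} (hy : ‖y‖ ≤ ρ) :
    -Real.log (u y + N) ≤ supBound (Fintype.card ι) lam Λ m / (1 - ρ ^ 2) ^ (m + 2) := by
  set n := Fintype.card ι with hn
  have hn0 : n ≠ 0 := Fintype.card_ne_zero
  set v := barrier m u N with hvdef
  have hpos : ∀ y ∈ closedBall (0 : E) 1, 0 < u y + N := fun y hy ↦ by linarith [hu0 y hy]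
  have hcu : ContinuousOn u (closedBall (0 : E) 1) := hu.continuousOn.mono hBU
  have hvc : ContinuousOn v (closedBall (0 : E) 1) := continuousOn_barrier hcu hpos
  -- the maximum of `v` on the closed ball
  obtain ⟨x₀, hx₀, hmax⟩ := (isCompact_closedBall (0 : E) 1).exists_isMaxOn
    ⟨0, mem_closedBall_self zero_le_one⟩ hvc
  set S := v x₀ with hS
  have hC₁ : 0 ≤ supBound n lam Λ m := supBound_nonneg n hlam0 hΛ0 m
  have hηρ : 0 < (1 - ρ ^ 2) ^ (m + 2) := pow_pos (by nlinarith) _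
  have hy1 : ‖y‖ < 1 := lt_of_le_of_lt hy hρ1
  have hyB : y ∈ closedBall (0 : E) 1 := mem_closedBall_zero_iff.2 hy1.le
  have hηy : (1 - ρ ^ 2) ^ (m + 2) ≤ eta m y := eta_ge hρ1 hy hρ0
  have hηy0 : 0 < eta m y := eta_pos hy1
  -- `v y ≤ S`, and `v y = η y · w y`
  have hvy : v y ≤ S := hmax hyB
  have hvw : v y = eta m y * -Real.log (u y + N) := rfl
  -- Step 1: `S ≤ C₁`
  have hSC : S ≤ supBound n lam Λ m := by
    by_cases hSpos : 0 < S
    · have hcore := barrier_core_estimate μ b hU hBU hu hu0 hN hf ha hlam0 hΛ0 hlam hΛ hsuper hα0 hα1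
        hβl hx₀ hmax hSpos
      -- `Ω' ∩ B_α ⊆ {u + N < 1} ∩ B₁ ∩ B_α`
      have hsub : posSet m u N ∩ ball (0 : E) α ⊆ {y | y ∈ ball (0 : E) 1 ∧ u y + N < 1} ∩ ball 0 α := by
        rintro z ⟨⟨hzB, hzv⟩, hzα⟩
        refine ⟨⟨hzB, ?_⟩, hzα⟩
        have hηz : 0 < eta m z := eta_pos (mem_ball_zero_iff.1 hzB)
        have hwz : 0 < -Real.log (u z + N) := pos_of_mul_pos_right (by exact hzv) hηz.le
        have hūz : 0 < u z + N := hpos z (ball_subset_closedBall hzB)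
        have : Real.log (u z + N) < 0 := by linarith
        exact (Real.log_neg_iff hūz).1 this
      have hω0 : μ (ball (0 : E) 1) ≠ 0 := (measure_ball_pos μ 0 one_pos).ne'
      have hωt : μ (ball (0 : E) 1) ≠ ∞ := measure_ball_lt_top.ne
      set K₁ := coreK₁ n lam Λ m with hK₁
      set K₂ := coreK₂ n lam Λ m α with hK₂
      set θ₀ := thetaZero n lam Λ m α with hθ₀
      have hK₁0 : 0 ≤ K₁ := coreK₁_nonneg n hlam0 hΛ0 m
      have hK₂0 : 0 ≤ K₂ := coreK₂_nonneg n hlam0 hΛ0 m hα1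
      have hθ₀0 : 0 ≤ θ₀ := (thetaZero_pos n hlam0 hΛ0 m hα1).le
      have h1 : ENNReal.ofReal ((S / 2) ^ n) * μ (ball (0 : E) 1) ≤
          ENNReal.ofReal (K₁ + K₂ * S ^ n * θ₀) * μ (ball (0 : E) 1) := by
        refine hcore.trans ?_
        have e2 : ENNReal.ofReal (2 ^ n * ((2 * ((m + 2 : ℕ) : ℝ) * (n * Λ) / (1 - α ^ 2)) /
            (n * lam)) ^ n * S ^ n) = ENNReal.ofReal (K₂ * S ^ n) := by rw [hK₂, coreK₂]
        rw [e2, show (2 : ℝ) ^ n * ((4 * ((m + 2 : ℕ) : ℝ) ^ 2 * Λ + 1) / (n * lam)) ^ n = K₁ from rfl]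
        calc ENNReal.ofReal K₁ * μ (ball (0 : E) 1) + ENNReal.ofReal (K₂ * S ^ n) * μ (posSet m u N ∩ ball 0 α)
            ≤ ENNReal.ofReal K₁ * μ (ball (0 : E) 1) +
                ENNReal.ofReal (K₂ * S ^ n) * (ENNReal.ofReal θ₀ * μ (ball (0 : E) 1)) :=
              add_le_add le_rfl (mul_le_mul_right ((measure_mono hsub).trans hθ) _)
          _ = ENNReal.ofReal (K₁ + K₂ * S ^ n * θ₀) * μ (ball (0 : E) 1) := by
              rw [ENNReal.ofReal_add hK₁0 (by positivity), add_mul,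
                ENNReal.ofReal_mul (by positivity : 0 ≤ K₂ * S ^ n), ← mul_assoc]
      have h2 : ENNReal.ofReal ((S / 2) ^ n) ≤ ENNReal.ofReal (K₁ + K₂ * S ^ n * θ₀) := by
        rw [mul_comm, mul_comm (ENNReal.ofReal (K₁ + K₂ * S ^ n * θ₀))] at h1
        exact (ENNReal.mul_le_mul_iff_right hω0 hωt).1 h1
      have h3 : (S / 2) ^ n ≤ K₁ + K₂ * S ^ n * θ₀ :=
        (ENNReal.ofReal_le_ofReal_iff (by positivity)).1 h2
      exact le_supBound_of_core hn0 hlam0 hΛ0 hα1 hSpos.le h3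
    · push Not at hSpos
      exact hSpos.trans hC₁
  -- Step 2: `w y ≤ C₁ / (1-ρ²)^{m+2}`
  by_cases hwy : -Real.log (u y + N) ≤ 0
  · exact hwy.trans (div_nonneg hC₁ hηρ.le)
  · push Not at hwy
    rw [le_div_iff₀ hηρ]
    calc -Real.log (u y + N) * (1 - ρ ^ 2) ^ (m + 2) ≤ -Real.log (u y + N) * eta m y :=
          mul_le_mul_of_nonneg_left hηy hwy.le
      _ = v y := by rw [hvw, mul_comm]
      _ ≤ supBound n lam Λ m := hvy.trans hSC

end Literature.Analysis.PDE.KrylovSafonov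

end
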